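import Summits.ValiantsHypothesis.ValiantsHypothesis.Theorems.SymmetroidPencilBasics
import Summits.ValiantsHypothesis.ValiantsHypothesis.Theorems.MatrixDescartes.Negative.MatrixDescartesWitness24

/-!
# `MatrixDescartes` census — certificate kit: one lemma that turns an alternation certificate into a row

HONEST FRAMING.  Bookkeeping for the object-search cell `pub-symmetroid` (finite census of real symmetric
lacunary pencils `F = ∑ l, X ^ (d l) • S l`).  The lemma below packages the three steps every census
certificate file repeats — specialise a would-be law `PosRootLawAt m K B` at an explicit symmetric pencil,
rewrite `det F` at a real point through a closed form `q`, and count sign alternations of `q` at `N + 1`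
increasing positive rational points (intermediate value theorem, tree lemma
`le_card_posRoots_of_alternating`) — so that a certificate file states its pencil literal ONCE (inside the
closed-form identity `eval_det`, from which `d` and `S` are read off by unification) and its closed form
once.  This is what lets rows with several-hundred-digit entries fit the gate's file-size limit.  Nothing
here bears on the asymptotic crux `Theses.LacunarySymmetroid.MatrixDescartes` (stmt-ValiantsHypothesis-18050)
nor on `VP ≠ VNP`.

[folklore] Elementary (intermediate value theorem).
-/

-- `Summit.ValiantsHypothesis.ValiantsHypothesis.…` repeats a component by the D-0017 layout
-- (single-conjunct summit), which the `dupNamespace` linter flags; the name is mandated.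
set_option linter.dupNamespace false

namespace Summit.ValiantsHypothesis.ValiantsHypothesis.Theorems.LacunarySymmetroidMatrixDescartes.Census

open Summit.ValiantsHypothesis.ValiantsHypothesis.Theorems.MatrixDescartes.Negative (PosRootLawAt)
open Summit.ValiantsHypothesis.ValiantsHypothesis.Theorems.SymmetroidDescartes (eval_det_pencil
  le_card_posRoots_of_alternating)
open scoped BigOperators Matrix
open Polynomial

/-- **Certificate ⇒ row (lower half).**  If an explicit symmetric pencil `F = ∑ l, X ^ (d l) • S l`
(`S l` real symmetric `m × m`, `K` terms) has `det F(t) = q t` for all real `t` (a closed form), and `q`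
alternates strictly in sign along `N + 1` strictly increasing positive points `τ 0 < ⋯ < τ N`, then `det F`
has at least `N` distinct positive real zeros, so no law "`Z₊ ≤ B`" with `B < N` holds at the format
`(m, K)`: `¬ PosRootLawAt m K B`.  In a certificate file `d`, `S` and `q` are supplied by unification from
the closed-form lemma passed as `hq`. [folklore] -/
theorem not_posRootLawAt_of_certificate {m K B N : ℕ} {d : Fin K → ℕ}
    {S : Fin K → Matrix (Fin m) (Fin m) ℝ} {q : ℝ → ℝ}
    (hq : ∀ t : ℝ, (∑ l, t ^ d l • S l).det = q t) (hS : ∀ l, (S l).IsSymm)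
    (τ : Fin (N + 1) → ℝ) (hτ : StrictMono τ) (hpos : ∀ j, 0 < τ j)
    (halt : ∀ j : Fin N, q (τ j.castSucc) * q (τ j.succ) < 0) (hB : B < N) :
    ¬ PosRootLawAt m K B := by
  intro h
  have hle := h d S hS
  have hN := le_card_posRoots_of_alternating
    ((∑ l, (X : ℝ[X]) ^ d l • (S l).map Polynomial.C).det) N τ hτ hpos (fun j => by
      rw [eval_det_pencil, eval_det_pencil, hq, hq]; exact halt j)
  omega

/-- The same certificate read as a plain count: `N ≤ Z₊(F)` (number of distinct positive real zeros of
`det F`), for files that also want the inequality itself. [folklore] -/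
theorem le_card_posRoots_of_certificate {m K N : ℕ} {d : Fin K → ℕ}
    {S : Fin K → Matrix (Fin m) (Fin m) ℝ} {q : ℝ → ℝ}
    (hq : ∀ t : ℝ, (∑ l, t ^ d l • S l).det = q t)
    (τ : Fin (N + 1) → ℝ) (hτ : StrictMono τ) (hpos : ∀ j, 0 < τ j)
    (halt : ∀ j : Fin N, q (τ j.castSucc) * q (τ j.succ) < 0) :
    N ≤ (((∑ l, (X : ℝ[X]) ^ d l • (S l).map Polynomial.C).det).roots.toFinset.filter
      (fun t => 0 < t)).card :=
  le_card_posRoots_of_alternating _ N τ hτ hpos (fun j => by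
    rw [eval_det_pencil, eval_det_pencil, hq, hq]; exact halt j)

end Summit.ValiantsHypothesis.ValiantsHypothesis.Theorems.LacunarySymmetroidMatrixDescartes.Census
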